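import Mathlib.Analysis.SpecialFunctions.Exp
import Mathlib.Analysis.Complex.ExponentialBounds
import Literature.Barriers.ValiantsHypothesis.UnpaddedShiftedPartialsPowerSum
import Literature.Barriers.ValiantsHypothesis.ShiftedPartialsCaseC2
import Literature.Barriers.ValiantsHypothesis.ShiftedPartialsCaseC3
import HarnessLib

/-!
# Case 3 of the printed proof of Gesmundo–Landsberg's Theorem 2: the power-sum degeneration is
too small for EVERY `m ≥ 5` — the numerical condition, discharged

Companion to `UnpaddedShiftedPartialsPowerSum.lean` (Gesmundo–Landsberg, Theory of Computing 15
(2019), art. 3 = arXiv:1705.03866, §4, Case 3 of the proof of Thm. 2 = Thm. 1.2 of the journal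
version). That file shows that the degeneration `P = y_1^m + ⋯ + y_{m²}^m` of `IMM^m_n` used in the
printed Case 3 ("it will suffice to prove the result for the shifted partials of both polynomials in
`m²` variables because the remaining `mn² - m²` variables will contribute the same growth to both
ideals") has strictly fewer order-`s` shifted partials of shift `τ` than `perm_m` in the `N = mn²`
variables (`powerSum_lt_perm_of_lt`, `exists_case3_degeneration_lt`) UNDER the numerical hypothesis
`m² · binom(N+τ-1, τ) < binom(m,s)² · binom(N-m²+τ-1, τ)`, whose validity is asserted there in prose
("true for all `2 ≤ s ≤ m-2` and `τ < (N-m²) ln(binom(m,s)²/m²)/m²`").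

This file PROVES that hypothesis in an explicit uniform range and so makes the conclusion
unconditional:

* `choose_add_vars_le_choose_mul_pow`: `binom(N+a+τ-1, τ) ≤ binom(N+τ-1, τ) · (1 + τ/N)^a`
  (adding `a` variables; the ratio is `∏_{j<a} (N+τ+j)/(N+j)`);
* `one_add_div_pow_lt_three`: `(1 + τ/N)^a ≤ e^{aτ/N} ≤ e < 3` when `a τ ≤ N`;
* `three_mul_sq_le_choose_sq`: `3 m² ≤ binom(m,2)² ≤ binom(m,s)²` for `m ≥ 5`, `2 ≤ s ≤ m - 2`;
* `powerSum_count_lt_perm_count`, `case3_count_lt`: hence the hypothesis holds for all `m ≥ 5`,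
  `2 ≤ s ≤ m - 2` and `τ` with `m²(τ + 1) + 1 ≤ mn²` (i.e. `τ ≤ n²/m - 1 - 1/m²`);
* `exists_case3_degeneration_lt_of_le`: in that range an element of `End · IMM^m_n` — the printed
  Case-3 degeneration — has STRICTLY smaller shifted-partials rank than the permanent (any field);
* `exists_case3_degeneration_lt_printedRange`: in particular for every `m ≥ 5`, `n > m⁵`,
  `2 ≤ s < m/2` at `τ = m³ + 1`, i.e. inside the printed range "`s < m/2` and `τ > m³`" of Case 3,
  for EVERY `m ≥ 5` (not only at sample parameters).

So the reduction sentence of the printed Case 3 fails throughout `m³ < τ ≤ n²/m - 2` for all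
`m ≥ 5`, `2 ≤ s < m/2`; together with `UnpaddedShiftedPartialsProofs.lean` (Cases 1–2,
`gesmundoLandsberg_thm2_printedRange`: `⌈m/2⌉ ≤ e ∨ τ ≤ m³`) this delimits exactly what the printed
proof of Thm. 2 establishes. Nothing here refutes Thm. 2 itself, which stays the named fact
`GesmundoLandsberg2017_thm2`. (For `s ∈ {0, 1}` the power sum is not too small at shift `0` — both
sides have `1`, resp. `m²`, independent derivatives — and nothing is claimed here.)

## References

* [GesmundoLandsberg2017] F. Gesmundo, J. M. Landsberg, Theory Comput. 15 (2019), art. 3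
  (arXiv:1705.03866), §4 (proof of Thm. 2 = journal Thm. 1.2), Case 3.
-/

noncomputable section

namespace Literature.Barriers.ValiantsHypothesis

open MvPolynomial Literature.Computability.AlgebraicComplexity

/-! ### Numerics: adding `a` variables multiplies `binom(N+τ-1, τ)` by at most `(1 + τ/N)^a` -/

section Numeric

open Real

/-- `binom(N+a+τ-1, τ) ≤ binom(N+τ-1, τ) · (1 + τ/N)^a` for `N ≥ 1`: the ratio is
`∏_{j<a} (N+τ+j)/(N+j)` (`choose_add_mul_prod`). [folklore] -/
theorem choose_add_vars_le_choose_mul_pow (N a τ : ℕ) (hN : 1 ≤ N) :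
    ((N + a + τ - 1).choose τ : ℝ) ≤ ((N + τ - 1).choose τ : ℝ) * (1 + (τ : ℝ) / N) ^ a := by
  have hid := choose_add_mul_prod (N + τ - 1) (N - 1) a
  have e1 : (N + τ - 1 + a).choose (N - 1 + a) = (N + a + τ - 1).choose τ := by
    rw [show N + τ - 1 + a = (N - 1 + a) + τ by omega, Nat.choose_symm_add,
      show N - 1 + a + τ = N + a + τ - 1 by omega]
  have e2 : (N + τ - 1).choose (N - 1) = (N + τ - 1).choose τ := by
    rw [show N + τ - 1 = (N - 1) + τ by omega]; exact Nat.choose_symm_add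
  rw [e1, e2] at hid
  have hNpos : (0 : ℝ) < N := by exact_mod_cast hN
  have hprod_pos : (0 : ℝ) < ∏ j ∈ Finset.range a, (((N - 1 : ℕ) : ℝ) + 1 + j) :=
    Finset.prod_pos fun j _ => by positivity
  have hprod_le : ∏ j ∈ Finset.range a, (((N + τ - 1 : ℕ) : ℝ) + 1 + j) ≤
      (1 + (τ : ℝ) / N) ^ a * ∏ j ∈ Finset.range a, (((N - 1 : ℕ) : ℝ) + 1 + j) := by
    rw [← Finset.card_range a, ← Finset.prod_const, Finset.card_range, ← Finset.prod_mul_distrib]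
    refine Finset.prod_le_prod (fun j _ => by positivity) fun j _ => ?_
    have h1 : (((N + τ - 1 : ℕ) : ℝ) + 1 + j) = ((N : ℝ) + j) + τ := by
      have h := congrArg (Nat.cast : ℕ → ℝ) (show (N + τ - 1 : ℕ) + 1 = N + τ by omega)
      push_cast at h; linarith
    have h2 : (((N - 1 : ℕ) : ℝ) + 1 + j) = (N : ℝ) + j := by
      have h := congrArg (Nat.cast : ℕ → ℝ) (show (N - 1 : ℕ) + 1 = N by omega)
      push_cast at h; linarith
    rw [h1, h2, add_mul, one_mul, add_le_add_iff_left, div_mul_eq_mul_div, le_div_iff₀ hNpos]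
    have : (0 : ℝ) ≤ j := by positivity
    nlinarith
  have := mul_le_mul_of_nonneg_left hprod_le
    (by positivity : (0 : ℝ) ≤ ((N + τ - 1).choose τ : ℝ))
  rw [← hid, ← mul_assoc] at this
  exact le_of_mul_le_mul_right this hprod_pos

/-- `(1 + τ/N)^a < 3` when `a τ ≤ N` (`N ≥ 1`): `(1 + x)^a ≤ e^{a x} ≤ e < 3`. [folklore] -/
theorem one_add_div_pow_lt_three {N a τ : ℕ} (hN : 1 ≤ N) (h : a * τ ≤ N) :
    (1 + (τ : ℝ) / N) ^ a < 3 := by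
  have hNpos : (0 : ℝ) < N := by exact_mod_cast hN
  calc (1 + (τ : ℝ) / N) ^ a ≤ (Real.exp ((τ : ℝ) / N)) ^ a := by
        refine pow_le_pow_left₀ (by positivity) ?_ a
        have := Real.add_one_le_exp ((τ : ℝ) / N)
        linarith
    _ = Real.exp (a * ((τ : ℝ) / N)) := by rw [← Real.exp_nat_mul]
    _ ≤ Real.exp 1 := by
        refine Real.exp_le_exp.2 ?_
        rw [mul_div_assoc', div_le_one hNpos]
        exact_mod_cast h
    _ < 3 := by
        have := Real.exp_one_lt_d9
        linarith

/-- `3 m² ≤ binom(m, s)²` for `m ≥ 5` and `2 ≤ s ≤ m - 2` (`binom(m,s) ≥ binom(m,2) = m(m-1)/2` and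
`(m-1)² ≥ 12`). [folklore] -/
theorem three_mul_sq_le_choose_sq {m s : ℕ} (hm : 5 ≤ m) (hs : 2 ≤ s) (hsm : s + 2 ≤ m) :
    3 * (m * m) ≤ (m.choose s) ^ 2 := by
  have h2 : m.choose 2 ≤ m.choose s := by
    by_cases hhalf : s ≤ m / 2
    · exact choose_le_choose_of_le_half hs hhalf
    · rw [← Nat.choose_symm (by omega : s ≤ m)]
      exact choose_le_choose_of_le_half (by omega) (by omega)
  have hc2 : m * (m - 1) = 2 * m.choose 2 := by
    rw [Nat.choose_two_right, Nat.mul_div_cancel' (Nat.even_mul_pred_self m).two_dvd]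
  have h3 : 3 * (m * m) ≤ (m.choose 2) ^ 2 := by
    have h4 : 4 * (3 * (m * m)) ≤ 4 * (m.choose 2) ^ 2 := by
      have h5 : 4 * (m.choose 2) ^ 2 = (m - 1) ^ 2 * (m * m) := by
        rw [show 4 * (m.choose 2) ^ 2 = (2 * m.choose 2) ^ 2 by ring, ← hc2]; ring
      have h6 : 12 ≤ (m - 1) ^ 2 := by
        have : 4 ≤ m - 1 := by omega
        calc 12 ≤ 4 ^ 2 := by norm_num
          _ ≤ (m - 1) ^ 2 := Nat.pow_le_pow_left this 2
      rw [h5]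
      calc 4 * (3 * (m * m)) = 12 * (m * m) := by ring
        _ ≤ (m - 1) ^ 2 * (m * m) := Nat.mul_le_mul_right _ h6
    exact Nat.le_of_mul_le_mul_left h4 (by norm_num)
  exact h3.trans (Nat.pow_le_pow_left h2 2)

/-- **The count**: for `m ≥ 5`, `2 ≤ s ≤ m - 2`, `z ≤ m²` and `N ≥ m²τ + 1`,
`z · binom(N + m² + τ - 1, τ) < binom(m,s)² · binom(N + τ - 1, τ)`. [folklore] -/
theorem powerSum_count_lt_perm_count {m s z N τ : ℕ} (hm : 5 ≤ m) (hs : 2 ≤ s) (hsm : s + 2 ≤ m)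
    (hz : z ≤ m * m) (hN : m * m * τ + 1 ≤ N) :
    z * (N + m * m + τ - 1).choose τ < (m.choose s) ^ 2 * (N + τ - 1).choose τ := by
  have hN1 : 1 ≤ N := by omega
  have hchoose_pos : 0 < (N + τ - 1).choose τ := Nat.choose_pos (by omega)
  have hR : (z : ℝ) * ((N + m * m + τ - 1).choose τ : ℝ) <
      ((m.choose s) ^ 2 : ℕ) * ((N + τ - 1).choose τ : ℝ) := by
    have h1 := choose_add_vars_le_choose_mul_pow N (m * m) τ hN1
    have h2 := one_add_div_pow_lt_three (a := m * m) (τ := τ) hN1 (by omega)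
    have h3 : ((3 * (m * m) : ℕ) : ℝ) ≤ ((m.choose s) ^ 2 : ℕ) := by
      exact_mod_cast three_mul_sq_le_choose_sq hm hs hsm
    have hzR : (z : ℝ) ≤ (m * m : ℕ) := by exact_mod_cast hz
    have hCpos : (0 : ℝ) < ((N + τ - 1).choose τ : ℝ) := by exact_mod_cast hchoose_pos
    have hC'nn : (0 : ℝ) ≤ ((N + m * m + τ - 1).choose τ : ℝ) := by positivity
    push_cast at h3 hzR ⊢
    have hm0 : (0 : ℝ) < (m : ℝ) * m := by
      have : (5 : ℝ) ≤ m := by exact_mod_cast hm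
      positivity
    calc (z : ℝ) * ((N + m * m + τ - 1).choose τ : ℝ)
        ≤ ((m : ℝ) * m) * (((N + τ - 1).choose τ : ℝ) * (1 + (τ : ℝ) / N) ^ (m * m)) :=
          mul_le_mul hzR h1 hC'nn hm0.le
      _ < ((m : ℝ) * m) * (((N + τ - 1).choose τ : ℝ) * 3) :=
          mul_lt_mul_of_pos_left (mul_lt_mul_of_pos_left h2 hCpos) hm0
      _ = 3 * ((m : ℝ) * m) * ((N + τ - 1).choose τ : ℝ) := by ring
      _ ≤ ((m.choose s) : ℝ) ^ 2 * ((N + τ - 1).choose τ : ℝ) :=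
          mul_le_mul_of_nonneg_right h3 hCpos.le
  exact_mod_cast hR

/-- **The numerical hypothesis of `powerSum_lt_perm_of_lt` / `exists_case3_degeneration_lt` holds**
for all `m ≥ 5`, `2 ≤ s ≤ m - 2` and `τ` with `m²(τ+1) + 1 ≤ mn²` (`N = #(Fin m × Fin n × Fin n) = mn²`,
`N - m² ≥ m²τ + 1`). [cite: GesmundoLandsberg2017, §4 (Case 3)] -/
theorem case3_count_lt {m n s τ : ℕ} (hm : 5 ≤ m) (hs : 2 ≤ s) (hsm : s + 2 ≤ m)
    (hτ : m * m * τ + 1 + m * m ≤ m * n ^ 2) :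
    m * m * (Fintype.card (Fin m × Fin n × Fin n) + τ - 1).choose τ <
      (m.choose s) ^ 2 * ((Fintype.card (Fin m × Fin n × Fin n) - m * m) + τ - 1).choose τ := by
  have hcard : Fintype.card (Fin m × Fin n × Fin n) = m * n ^ 2 := by
    simp only [Fintype.card_prod, Fintype.card_fin, sq]
  rw [hcard]
  have h := powerSum_count_lt_perm_count (N := m * n ^ 2 - m * m) (τ := τ) hm hs hsm le_rfl (by omega)
  rwa [show m * n ^ 2 - m * m + m * m = m * n ^ 2 by omega] at h

end Numeric

/-! ### The printed Case-3 degeneration is too small, unconditionally -/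

section Unconditional

variable (K : Type) [Field K]

/-- **The printed Case-3 degeneration does not dominate the permanent, for all `m ≥ 5`**: for
`2 ≤ s ≤ m - 2`, `m² ≤ n`, every `τ` with `m²(τ+1) + 1 ≤ mn²` (all `τ ≤ n²/m - 2`) and every injective
placement `ι` of the permanent, some `P ∈ End · IMM^m_n` — the power sum `Σ_{i ∈ S} (x⁽⁰⁾ᵢᵢ)^m`,
`#S = m²`, of GL §4, Case 3 — has `rank(P_{(s,·)[τ]}) < rank((perm_m)_{(s,m-s)[τ]})` in the `mn²`
variables (`exists_case3_degeneration_lt` with its numerical hypothesis discharged by `case3_count_lt`).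
[cite: GesmundoLandsberg2017, §4 (Case 3)] -/
theorem exists_case3_degeneration_lt_of_le {m n s τ : ℕ} (hm : 5 ≤ m) (hmn : m * m ≤ n)
    (hs : 2 ≤ s) (hsm : s + 2 ≤ m) (hτ : m * m * τ + 1 + m * m ≤ m * n ^ 2)
    (ι : Fin m × Fin m → Fin m × Fin n × Fin n) (hι : Function.Injective ι) :
    ∃ P ∈ endOrbit (Fin m × Fin n × Fin n) K (immPoly n m K),
      shiftedPartialsRank K s τ P < shiftedPartialsRank K s τ (rename ι (perPoly (Fin m) K)) := by
  haveI : NeZero m := ⟨by omega⟩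
  exact exists_case3_degeneration_lt K hmn ι hι s τ (case3_count_lt hm hs hsm hτ)

/-- **Inside the printed range of Case 3 for every `m ≥ 5`** (`n > m⁵`, `s < m/2`, `τ > m³`): with
`2 ≤ s`, `2s < m` and `τ = m³ + 1` there is `P ∈ End · IMM^m_n` (the printed power-sum degeneration) with
`rank(P_{(s,·)[m³+1]}) < rank((perm_m)_{(s,m-s)[m³+1]})`; so the sentence "it will suffice to prove the
result for the shifted partials of both polynomials in `m²` variables" is not a valid reduction there, and
the chain `rank IMM^m_n ≥ rank P ≥ rank perm_m` of the printed Case 3 breaks at its second link.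
[cite: GesmundoLandsberg2017, §4 (Case 3) and Thm. 2] -/
theorem exists_case3_degeneration_lt_printedRange {m n s : ℕ} (hm : 5 ≤ m) (hn : m ^ 5 < n)
    (hs : 2 ≤ s) (h2s : 2 * s < m) (ι : Fin m × Fin m → Fin m × Fin n × Fin n)
    (hι : Function.Injective ι) :
    ∃ P ∈ endOrbit (Fin m × Fin n × Fin n) K (immPoly n m K),
      shiftedPartialsRank K s (m ^ 3 + 1) P <
        shiftedPartialsRank K s (m ^ 3 + 1) (rename ι (perPoly (Fin m) K)) := by
  have hmm : m * m ≤ m ^ 5 := by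
    calc m * m = m ^ 2 := (sq m).symm
      _ ≤ m ^ 5 := Nat.pow_le_pow_right (by omega) (by omega)
  have hmn : m * m ≤ n := hmm.trans hn.le
  have hτ : m * m * (m ^ 3 + 1) + 1 + m * m ≤ m * n ^ 2 := by
    have h3 : m ^ 5 ≤ n ^ 2 := hn.le.trans (Nat.le_self_pow (by norm_num) n)
    have h1 : 1 ≤ m ^ 5 := Nat.one_le_pow _ _ (by omega)
    calc m * m * (m ^ 3 + 1) + 1 + m * m = m ^ 5 + 2 * (m * m) + 1 := by ring
      _ ≤ 4 * m ^ 5 := by linarith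
      _ ≤ m * m ^ 5 := Nat.mul_le_mul_right _ (by omega : 4 ≤ m)
      _ ≤ m * n ^ 2 := Nat.mul_le_mul_left _ h3
  exact exists_case3_degeneration_lt_of_le K hm hmn hs (by omega) hτ ι hι

end Unconditional

end Literature.Barriers.ValiantsHypothesis
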